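import Literature.IUT.HodgeArakelov.GaloisPairRigidity
import Literature.IUT.HodgeArakelov.AbsTopMonoidsNonVacuity
import Literature.IUT.HodgeArakelov.PlusMinusTowerCyclicToy
import HarnessLib

/-!
# [IUTchII] Rmk. 1.11.1 (i) (a)/(b): the named facts `Rmk1111_a A`, `Rmk1111_b A zhatPow` are SCHEMAS over the interface
# `AbsTopMonoids` — universal-closure certificates at a trivial-action inhabitant (proof-only)

S. Mochizuki, *Inter-universal Teichmüller theory II*, §1, Remark 1.11.1 (i) (a), (b), kurims manuscript (Dec. 2020) pp. 49–50
[claim: Mochizuki2012, status: disputed] (IUTchII §1 Rmk 1.11.1 (i), kurims pp.49-50); cited there: [AbsTopIII] Prop. 3.2 (iv), Prop. 3.3 (ii).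
abc-iut cell, D-0079 L-K «cone below S, unconditional», K-L6 slice (abc-iut-w4-d007 gen 10, row «KL6-CLOSURE-CERTS»).  PROOF-ONLY
companion of abc-iut-L6-t1's `GaloisPairRigidity.lean` (no `def`, no `instance`, nothing re-typed), over abc-iut-w5-d114's
`AbsTopMonoidsNonVacuity.lean` (`deltaOf`, `quotDeltaOfIso`) and abc-iut-w5-d243's cyclic toy setting (`cyclicThetaSetting`).

The frozen FACT-LIST rows **F-0417** `Rmk1111_a` (label `conditional`) and **F-0418** `Rmk1111_b` (label `fact-open` — the last
«fact-open» input of the L6 certificate) occur in HYPOTHESIS position inside the typed statement of the cone row IUTchII:Prop3.4(ii)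
(abc-iut-w5-d012 `L6-SLICE-INPUT-CENSUS-v2`, ca24e4516e42b12c).  The tree holds their instance forms AT THE GENUINE PRODUCERS
(`AbsTopMonoids.rmk1111_a_genuineOfModel` / `…Ism`, `AbsTopMonoids.rmk1111_b_genuineOfModel` / `…Ism` with the `Ẑ^×`-action SUPPLIED
as `Genuine.zhatPowOunits`, abc-iut-w6-d010; `Rmk1111_a_of_isTMPair`, `Rmk1111_b_surjective`, abc-iut-w6-d016) but no decision of the
universal closures.  Both are predicates on an ARBITRARY `A : AbsTopMonoids S` — abc-iut-L6-t1's interface record of the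
`Aut`-functorial monoids `G ↦ (G ↷ O^⊳(G))`, `Π ↦ (Π ↷ M_TM(Π))` of [IUTchII] Ex. 1.8, whose laws are functoriality/equivariance only;
nothing ties the action `G ↷ O^⊳(G)` to the MLF-Galois pair `G_k ↷ 𝒪^⊳_{k̄}`.  In particular the interface admits the inhabitant
«`O^⊳(G) := ℤ` (multiplicatively) with the TRIVIAL `G`-action» (`exists_absTopMonoids_not_rmk1111`, built like abc-iut-w5-d114's
`AbsTopMonoids.degenerate` over the cyclic toy setting, where (H1)/(H2) of `AbsTopMonoids.nonempty_iff` hold trivially).  There the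
automorphism group of the pair `G ↷ O^×(G)` is ALL of `Aut(G) × Aut(O^×(G))`, so:
* (a) `Aut(G ↷ O^⊳(G)) → Aut(G)` is not injective — the pair automorphism `(id, x ↦ x⁻¹)` lies over `id` — `¬ Rmk1111_a A`;
* (b) for the `Ẑ^×`-action datum `zhatPow := 1` the kernel clause «every pair automorphism over `id` is a `Ẑ^×`-power» fails at the
  same element — `¬ Rmk1111_b A 1` (the surjectivity clause holds for every `A`, `Rmk1111_b_surjective`; it is the KERNEL description
  that is the content, exactly as abc-iut-w6-d016's `Rmk1111_b_iff_kernel` isolated).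
Hence the CLOSED certificates `not_forall_rmk1111_a`, `not_forall_rmk1111_b`: the universal closures of F-0417 / F-0418 are FALSE;
the rows are consumable only in instance form at the genuine producers (FACT-LIST class «universal-closure REFUTED / schema; instance
forms …»).

HONEST FRAMING: a refuted universal closure is a statement about OUR typing (the interface admits the trivial action), not about the
printed remark ([AbsTopIII] Prop. 3.2 (iv) / 3.3 (ii) concern the genuine pair `G_k ↷ 𝒪^⊳_{k̄}`, where the cited instance-form
theorems apply); nothing here bears on [IUTchIII] Cor. 3.12 or takes a side; typed ≠ proved; nothing asserts abc proved or refuted.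
-/

noncomputable section

namespace Literature.IUT.HodgeArakelov

open CategoryTheory Multiplicative

/-- **IUTchII:Rmk1.11.1(i)** (kurims pp.49-50) A trivial-action inhabitant of the interface `AbsTopMonoids` over abc-iut-w5-d243's
cyclic toy setting (`Π_v = 1`, `G_v = 1`): `O^⊳(G) := M_TM(Π) := ℤ` (multiplicatively) with TRIVIAL actions and identity
transports, `Δ(Π*) :=` the transport of `Δ`, `Ism` trivial.  At it (a) `Rmk1111_a` FAILS and (b) `Rmk1111_b A 1` FAILS: the pair
automorphism `(id, x ↦ x⁻¹)` of `G ↷ O^×(G)` lies over `id ∈ Aut(G)` and is not a `Ẑ^×`-power for `zhatPow := 1`.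
[claim: Mochizuki2012, status: disputed] (IUTchII §1 Rmk 1.11.1 (i), kurims pp.49-50) -/
theorem exists_absTopMonoids_not_rmk1111 :
    ∃ A : AbsTopMonoids (CyclicToy.cyclicThetaSetting 3 5 Nat.prime_three (by decide) Nat.prime_five (by decide) (by decide)),
      ¬ Rmk1111_a A ∧ ¬ Rmk1111_b A (fun _ => 1) := by
  set S₀ := CyclicToy.cyclicThetaSetting 3 5 Nat.prime_three (by decide) Nat.prime_five (by decide) (by decide) with hS₀
  -- (H1): `Δ = Ker(Π_v ↠ G_v) = Π_v` is characteristic (everything is trivial)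
  have hΔ : ∀ f : S₀.PiX ≃ₜ* S₀.PiX, S₀.DeltaX.map f.toMulEquiv.toMonoidHom = S₀.DeltaX := by
    intro f
    have htop : S₀.DeltaX = ⊤ := MonoidHom.ker_one
    rw [htop, ← MonoidHom.range_eq_map, MonoidHom.range_eq_top]
    exact f.surjective
  -- (H2): `Π_v/Δ ≅ G_v` (both trivial)
  have hq : Nonempty (TopGroup.quot S₀.PiX S₀.DeltaX ≃ₜ* S₀.Gk) :=
    ⟨{ toFun := fun _ => 1
       invFun := fun _ => 1
       left_inv := fun x => by
         induction x using QuotientGroup.induction_on with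
         | H z => exact ((QuotientGroup.eq_one_iff z).mpr (MonoidHom.mem_ker.mpr (Subsingleton.elim _ _))).symm
       right_inv := fun _ => Subsingleton.elim _ _
       map_mul' := fun _ _ => (mul_one _).symm
       continuous_toFun := continuous_const
       continuous_invFun := continuous_const }⟩
  let A : AbsTopMonoids S₀ :=
    { Otri := fun _ => Multiplicative ℤ
      actOtri := fun _ => 1
      mapOtri := fun _ => MulEquiv.refl _
      mapOtri_id := fun _ => rfl
      mapOtri_comp := fun _ _ => rfl
      mapOtri_equivariant := fun _ _ _ => rfl
      MTM := fun _ => Multiplicative ℤ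
      actMTM := fun _ => 1
      mapMTM := fun _ => MulEquiv.refl _
      mapMTM_id := fun _ => rfl
      mapMTM_comp := fun _ _ => rfl
      mapMTM_equivariant := fun _ _ _ => rfl
      Delta := fun P => AbsTopMonoids.deltaOf P
      Delta_map := fun f => AbsTopMonoids.deltaOf_map hΔ f
      Delta_base := AbsTopMonoids.deltaOf_base hΔ
      quotIso := fun P => ⟨(AbsTopMonoids.quotDeltaOfIso P).trans (Classical.choice hq)⟩
      tauto := fun _ => MulEquiv.refl _
      tauto_equivariant := fun _ _ _ => rfl
      Ism := fun _ => PUnit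
      actIsm := fun _ => 1
      toIsm := fun _ => 1 }
  -- the reference isomorph `G := G_v`
  let G₀ : IsoClass S₀.Gk := IsoClass.base S₀.Gk
  refine ⟨A, ?_, ?_⟩
  · -- (a): the pair automorphism `(id, x ↦ x⁻¹)` of `G ↷ O^⊳(G)` lies over `id`, so `forget` is not injective
    let ψ : MulAut (A.Otri G₀) := MulEquiv.inv (A.Otri G₀)
    have hmem : ((1 : Aut G₀), ψ) ∈ PairAut G₀ (A.Otri G₀) (A.actOtri G₀) := fun _ _ => rfl
    have hψ : ψ ≠ 1 := by
      intro h
      have h1 := congrArg (fun φ : MulAut (A.Otri G₀) => toAdd (φ (ofAdd (1 : ℤ)))) h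
      change toAdd ((ofAdd (1 : ℤ))⁻¹) = toAdd (ofAdd (1 : ℤ)) at h1
      simp at h1
    intro h
    have hinj := (h G₀).1
    have key : PairAut.forget (⟨((1 : Aut G₀), ψ), hmem⟩ : PairAut G₀ (A.Otri G₀) (A.actOtri G₀)) =
        PairAut.forget (1 : PairAut G₀ (A.Otri G₀) (A.actOtri G₀)) := rfl
    have h2 : (⟨((1 : Aut G₀), ψ), hmem⟩ : PairAut G₀ (A.Otri G₀) (A.actOtri G₀)) = 1 := hinj key
    exact hψ (congrArg (fun q : PairAut G₀ (A.Otri G₀) (A.actOtri G₀) => q.1.2) h2)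
  · -- (b): the pair automorphism `(id, x ↦ x⁻¹)` of `G ↷ O^×(G)` lies over `id` and is no `Ẑ^×`-power for `zhatPow := 1`
    have hact : ∀ (g : G₀.G) (u : A.Ounits G₀), A.actOunits G₀ g u = u := fun g u => Units.ext rfl
    let ψ : MulAut (A.Ounits G₀) := MulEquiv.inv (A.Ounits G₀)
    have hmem : ((1 : Aut G₀), ψ) ∈ PairAut G₀ (A.Ounits G₀) (A.actOunits G₀) := by
      intro g m
      change ψ (A.actOunits G₀ g m) = A.actOunits G₀ _ (ψ m)
      rw [hact, hact]
    have hψ : ψ ≠ 1 := by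
      intro h
      have h1 : (toUnits (ofAdd (1 : ℤ)) : (Multiplicative ℤ)ˣ)⁻¹ = toUnits (ofAdd (1 : ℤ)) :=
        MulEquiv.congr_fun h (toUnits (ofAdd (1 : ℤ)))
      have h2 : (ofAdd (1 : ℤ))⁻¹ = ofAdd (1 : ℤ) := congrArg Units.val h1
      have h3 := congrArg toAdd h2
      simp at h3
    intro h
    obtain ⟨u, hu⟩ := (h G₀).2.1 ⟨((1 : Aut G₀), ψ), hmem⟩ rfl
    exact hψ hu

/-- **F-0417 is a schema**: the universal closure of `Rmk1111_a` (over all settings `S` and all `A : AbsTopMonoids S`) is FALSE; the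
instance forms the cone uses are `AbsTopMonoids.rmk1111_a_genuineOfModel` / `rmk1111_a_genuineOfModelIsm` / `Rmk1111_a_of_isTMPair`.
[claim: Mochizuki2012, status: disputed] (IUTchII §1 Rmk 1.11.1 (i), kurims pp.49-50) -/
theorem not_forall_rmk1111_a : ¬ ∀ (S : ThetaSetting.{0}) (A : AbsTopMonoids S), Rmk1111_a A := by
  intro h
  obtain ⟨A, hA, -⟩ := exists_absTopMonoids_not_rmk1111
  exact hA (h _ A)

/-- **F-0418 is a schema**: the universal closure of `Rmk1111_b` (over all settings `S`, all `A : AbsTopMonoids S` and all `Ẑ^×`-action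
data `zhatPow`) is FALSE; the instance forms the cone uses are `AbsTopMonoids.rmk1111_b_genuineOfModel` / `rmk1111_b_genuineOfModelIsm`
(with `zhatPow := Genuine.zhatPowOunits`), and `Rmk1111_b_surjective` (the surjectivity clause, every `A`).
[claim: Mochizuki2012, status: disputed] (IUTchII §1 Rmk 1.11.1 (i), kurims p.50) -/
theorem not_forall_rmk1111_b :
    ¬ ∀ (S : ThetaSetting.{0}) (A : AbsTopMonoids S) (zhatPow : ∀ G : IsoClass S.Gk, ZHatUnits →* MulAut (A.Ounits G)),
        Rmk1111_b A zhatPow := by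
  intro h
  obtain ⟨A, -, hA⟩ := exists_absTopMonoids_not_rmk1111
  exact hA (h _ A _)

end Literature.IUT.HodgeArakelov

end
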